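import Mathlib
import HarnessLib

/-!
# Borel-fixed `(110)`-candidates of `⟨3,3,3⟩`, I: block coordinates and admissible subspaces

Topic `Literature/Computability/AlgebraicComplexity`. Combinatorial half of the proof of
Conner–Harper–Landsberg 2023, Thm. 1.1 (`R̲(M⟨3⟩) ≥ 17`; CHL §6: "In the case of `M⟨3⟩`, the weight
zero subspace of `𝔰𝔩₃` has dimension two, so there are `𝔹`-fixed spaces … that arise in positive
dimensional families … There are eight `7`-planes that do pass the test"). A `(110)`-candidate
`E ⊆ A ⊗ B = K^{(i,k)} ⊗ K^{(i',j)}` of `⟨3,3,3⟩ = ∑ a_{ik} ⊗ b_{ij} ⊗ c_{jk}` lives on a `3 × 3`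
array of BLOCKS `(j, k)`, each a copy of `𝔤𝔩₃` with matrix position `(i, i')` (`MatMul3.blk`); the
slice `t(·,·,(j,k))` is the identity matrix of block `(j,k)`. This file (pure linear algebra over a
field, no border rank) defines

* `MatMul3.IsAdmissible E` — the intrinsic consequences of "graded, Borel fixed, contains the
  slices, `dim ≤ 16`": `E` contains the root-coordinate and block-diagonal components of its
  elements, the nine identity matrices, is stable under the derivations `ad X_{pq}` inside the
  blocks (`MatMul3.adU`) and under the block shifts `(q,k) ↦ (p,k)`, `(j,q) ↦ (j,p)`, `p < q`
  (`MatMul3.shiftV`, `MatMul3.shiftW`), and `dim E ≤ 16`;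
and proves the block-level consequences of admissibility (missing positive root ⇒ equal
diagonal entries, negative root ⇒ coroot, upper-set closure, monotonicity along rows/columns).

## References

* A. Conner, A. Harper, J. M. Landsberg, *New lower bounds for matrix multiplication and `det₃`*,
  Forum Math. Pi 11 (2023) e17, arXiv:1911.07981 — §2.5 (Borel fixed subspaces), §6, §7.
  [ConnerHarperLandsberg2023]
-/

noncomputable section

open scoped BigOperators

namespace Literature.Computability.AlgebraicComplexity

namespace BorderApolarity

namespace MatMul3

universe u

variable {K : Type u} [Field K]

/-- The index type `Fin 3 × Fin 3` of each slot of `⟨3,3,3⟩`. [folklore] -/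
abbrev I9' : Type := Fin 3 × Fin 3

/-! ## Block coordinates -/

/-- The coordinate of `A ⊗ B` in block `(j, k)` at matrix position `(i, i')`:
`a = (i, k)`, `b = (i', j)`. [cite: ConnerHarperLandsberg2023, §6] -/
def blk (j k i i' : Fin 3) : I9' × I9' := ((i, k), (i', j))

/-- Every coordinate is a block coordinate. [folklore] -/
theorem blk_eta (p : I9' × I9') : blk p.2.2 p.1.2 p.1.1 p.2.1 = p := rfl

/-- `blk` is injective in all four indices. [folklore] -/
theorem blk_inj {j k i i' j₁ k₁ i₁ i₁' : Fin 3} :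
    blk j k i i' = blk j₁ k₁ i₁ i₁' ↔ j = j₁ ∧ k = k₁ ∧ i = i₁ ∧ i' = i₁' := by
  simp only [blk, Prod.mk.injEq]
  tauto

/-- The root unit vector of block `(j,k)` at position `(i,i')`. [cite: ConnerHarperLandsberg2023, §2.5] -/
def unitVec (j k i i' : Fin 3) : I9' × I9' → K := Pi.single (blk j k i i') 1

/-- The diagonal vector of block `(j,k)` with diagonal `d`. [cite: ConnerHarperLandsberg2023, §2.5] -/
def diagVec (j k : Fin 3) (d : Fin 3 → K) : I9' × I9' → K :=
  fun p => if p.1.2 = k ∧ p.2.2 = j ∧ p.1.1 = p.2.1 then d p.1.1 else 0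

/-- Entries of `unitVec`. [folklore] -/
theorem unitVec_apply (j k i i' : Fin 3) (p : I9' × I9') :
    unitVec (K := K) j k i i' p = if p = blk j k i i' then 1 else 0 := by
  simp only [unitVec, Pi.single_apply]

/-- Entries of `diagVec` at block coordinates. [folklore] -/
@[simp] theorem diagVec_blk (j k : Fin 3) (d : Fin 3 → K) (j₁ k₁ i i' : Fin 3) :
    diagVec j k d (blk j₁ k₁ i i') = if k₁ = k ∧ j₁ = j ∧ i = i' then d i else 0 := rfl

/-- `diagVec` is linear in `d`. [folklore] -/
theorem diagVec_add (j k : Fin 3) (d d' : Fin 3 → K) :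
    diagVec j k (d + d') = diagVec j k d + diagVec j k d' := by
  funext p; simp only [diagVec, Pi.add_apply]; split_ifs <;> simp

/-- `diagVec` is linear in `d`. [folklore] -/
theorem diagVec_smul (j k : Fin 3) (c : K) (d : Fin 3 → K) :
    diagVec j k (c • d) = c • diagVec j k d := by
  funext p; simp only [diagVec, Pi.smul_apply, smul_eq_mul]; split_ifs <;> simp

/-- The block-diagonal projection: keep the diagonal entries of block `(j,k)`. [folklore] -/
def diagProj (j k : Fin 3) : (I9' × I9' → K) →ₗ[K] (I9' × I9' → K) where
  toFun x p := if p.1.2 = k ∧ p.2.2 = j ∧ p.1.1 = p.2.1 then x p else 0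
  map_add' x y := by funext p; simp only [Pi.add_apply]; split_ifs <;> simp
  map_smul' c x := by funext p; simp only [Pi.smul_apply, smul_eq_mul, RingHom.id_apply]; split_ifs <;> simp

/-- The block-diagonal projection is the diagonal vector of the diagonal entries. [folklore] -/
theorem diagProj_eq_diagVec (j k : Fin 3) (x : I9' × I9' → K) :
    diagProj j k x = diagVec j k fun i => x (blk j k i i) := by
  funext p
  simp only [diagProj, LinearMap.coe_mk, AddHom.coe_mk, diagVec]
  split_ifs with h
  · obtain ⟨h1, h2, h3⟩ := h
    congr 1
    rw [← blk_eta p, h1, h2, h3]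
    rfl
  · rfl

/-! ## The derivations and shifts of the Borel subalgebra -/

/-- The derivation `ad X_{pq}` of the `U`-root `(p, q)` inside every block:
`X ↦ X_{pq} X - X X_{pq}` on `𝔤𝔩₃`. [cite: ConnerHarperLandsberg2023, §2.5] -/
def adU (p q : Fin 3) : (I9' × I9' → K) →ₗ[K] (I9' × I9' → K) where
  toFun x c := (if c.1.1 = p then x ((q, c.1.2), c.2) else 0) -
    (if c.2.1 = q then x (c.1, (p, c.2.2)) else 0)
  map_add' x y := by funext c; simp only [Pi.add_apply]; split_ifs <;> ring
  map_smul' r x := by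
    funext c; simp only [Pi.smul_apply, smul_eq_mul, RingHom.id_apply]; split_ifs <;> ring

/-- The shift of block row `q` onto block row `p` (the `V`-root `(p, q)` on the index `j`).
[cite: ConnerHarperLandsberg2023, §2.5] -/
def shiftV (p q : Fin 3) : (I9' × I9' → K) →ₗ[K] (I9' × I9' → K) where
  toFun x c := if c.2.2 = p then x (c.1, (c.2.1, q)) else 0
  map_add' x y := by funext c; simp only [Pi.add_apply]; split_ifs <;> ring
  map_smul' r x := by
    funext c; simp only [Pi.smul_apply, smul_eq_mul, RingHom.id_apply]; split_ifs <;> ring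

/-- The shift of block column `q` onto block column `p` (the `W`-root `(p, q)` on the index `k`).
[cite: ConnerHarperLandsberg2023, §2.5] -/
def shiftW (p q : Fin 3) : (I9' × I9' → K) →ₗ[K] (I9' × I9' → K) where
  toFun x c := if c.1.2 = p then x ((c.1.1, q), c.2) else 0
  map_add' x y := by funext c; simp only [Pi.add_apply]; split_ifs <;> ring
  map_smul' r x := by
    funext c; simp only [Pi.smul_apply, smul_eq_mul, RingHom.id_apply]; split_ifs <;> ring

/-- Values of `adU` at block coordinates. [folklore] -/
theorem adU_blk (p q : Fin 3) (x : I9' × I9' → K) (j k i i' : Fin 3) :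
    adU p q x (blk j k i i') =
      (if i = p then x (blk j k q i') else 0) - (if i' = q then x (blk j k i p) else 0) := rfl

/-- Values of `shiftV` at block coordinates. [folklore] -/
theorem shiftV_blk (p q : Fin 3) (x : I9' × I9' → K) (j k i i' : Fin 3) :
    shiftV p q x (blk j k i i') = if j = p then x (blk q k i i') else 0 := rfl

/-- Values of `shiftW` at block coordinates. [folklore] -/
theorem shiftW_blk (p q : Fin 3) (x : I9' × I9' → K) (j k i i' : Fin 3) :
    shiftW p q x (blk j k i i') = if k = p then x (blk j q i i') else 0 := rfl

/-- Values of `unitVec` at block coordinates. [folklore] -/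
theorem unitVec_blk (j k i i' j₁ k₁ i₁ i₁' : Fin 3) :
    unitVec (K := K) j k i i' (blk j₁ k₁ i₁ i₁') =
      if j₁ = j ∧ k₁ = k ∧ i₁ = i ∧ i₁' = i' then 1 else 0 := by
  simp only [unitVec_apply, blk_inj]

/-- Values of a `Pi.single` at block coordinates. [folklore] -/
theorem single_blk (c : K) (j k i i' j₁ k₁ i₁ i₁' : Fin 3) :
    (Pi.single (blk j k i i') c : I9' × I9' → K) (blk j₁ k₁ i₁ i₁') =
      if j₁ = j ∧ k₁ = k ∧ i₁ = i ∧ i₁' = i' then c else 0 := by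
  simp only [Pi.single_apply, blk_inj]

/-- `ad X_{pq}` of a diagonal matrix is `(d_q - d_p) X_{pq}`. [folklore] -/
theorem adU_diagVec (p q j k : Fin 3) (d : Fin 3 → K) :
    adU p q (diagVec j k d) = (d q - d p) • unitVec (K := K) j k p q := by
  funext c
  rw [← blk_eta c, Pi.smul_apply, smul_eq_mul, adU_blk, diagVec_blk, diagVec_blk, unitVec_blk]
  grind

/-- `ad X_{pq}` of the root unit `X_{ii'}`: `[q = i] X_{p i'} - [i' = p] X_{i q}` (as coordinate
functions; the two terms may be diagonal). [folklore] -/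
theorem adU_unitVec (p q j k i i' : Fin 3) :
    adU p q (unitVec (K := K) j k i i') =
      (if q = i then Pi.single (blk j k p i') 1 else 0) -
        (if i' = p then Pi.single (blk j k i q) 1 else 0) := by
  funext c
  rw [← blk_eta c, adU_blk, unitVec_blk, unitVec_blk, Pi.sub_apply]
  have e1 : (if q = i then (Pi.single (blk j k p i') 1 : I9' × I9' → K) else 0)
      (blk c.2.2 c.1.2 c.1.1 c.2.1) =
      if q = i then (if c.2.2 = j ∧ c.1.2 = k ∧ c.1.1 = p ∧ c.2.1 = i' then 1 else 0) else 0 := by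
    split_ifs with h <;> simp [single_blk, *]
  have e2 : (if i' = p then (Pi.single (blk j k i q) 1 : I9' × I9' → K) else 0)
      (blk c.2.2 c.1.2 c.1.1 c.2.1) =
      if i' = p then (if c.2.2 = j ∧ c.1.2 = k ∧ c.1.1 = i ∧ c.2.1 = q then 1 else 0) else 0 := by
    split_ifs with h <;> simp [single_blk, *]
  rw [e1, e2]
  grind

/-- The block shift `shiftV p q` moves block `(q, k)` to block `(p, k)`. [folklore] -/
theorem shiftV_single (p q j k i i' : Fin 3) (c : K) :
    shiftV p q (Pi.single (blk j k i i') c) = if j = q then Pi.single (blk p k i i') c else 0 := by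
  funext x
  rw [← blk_eta x, shiftV_blk, single_blk]
  have e : (if j = q then (Pi.single (blk p k i i') c : I9' × I9' → K) else 0)
      (blk x.2.2 x.1.2 x.1.1 x.2.1) =
      if j = q then (if x.2.2 = p ∧ x.1.2 = k ∧ x.1.1 = i ∧ x.2.1 = i' then c else 0) else 0 := by
    split_ifs with h <;> simp [single_blk, *]
  rw [e]
  grind

/-- The block shift `shiftW p q` moves block `(j, q)` to block `(j, p)`. [folklore] -/
theorem shiftW_single (p q j k i i' : Fin 3) (c : K) :
    shiftW p q (Pi.single (blk j k i i') c) = if k = q then Pi.single (blk j p i i') c else 0 := by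
  funext x
  rw [← blk_eta x, shiftW_blk, single_blk]
  have e : (if k = q then (Pi.single (blk j p i i') c : I9' × I9' → K) else 0)
      (blk x.2.2 x.1.2 x.1.1 x.2.1) =
      if k = q then (if x.2.2 = j ∧ x.1.2 = p ∧ x.1.1 = i ∧ x.2.1 = i' then c else 0) else 0 := by
    split_ifs with h <;> simp [single_blk, *]
  rw [e]
  grind

/-- The block shift of a diagonal vector. [folklore] -/
theorem shiftV_diagVec (p q j k : Fin 3) (d : Fin 3 → K) :
    shiftV p q (diagVec j k d) = if j = q then diagVec p k d else 0 := by
  funext x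
  rw [← blk_eta x, shiftV_blk, diagVec_blk]
  have e : (if j = q then (diagVec p k d : I9' × I9' → K) else 0) (blk x.2.2 x.1.2 x.1.1 x.2.1) =
      if j = q then (if x.1.2 = k ∧ x.2.2 = p ∧ x.1.1 = x.2.1 then d x.1.1 else 0) else 0 := by
    split_ifs with h <;> simp [diagVec_blk, *]
  rw [e]
  grind

/-- The block shift of a diagonal vector. [folklore] -/
theorem shiftW_diagVec (p q j k : Fin 3) (d : Fin 3 → K) :
    shiftW p q (diagVec j k d) = if k = q then diagVec j p d else 0 := by
  funext x
  rw [← blk_eta x, shiftW_blk, diagVec_blk]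
  have e : (if k = q then (diagVec j p d : I9' × I9' → K) else 0) (blk x.2.2 x.1.2 x.1.1 x.2.1) =
      if k = q then (if x.1.2 = p ∧ x.2.2 = j ∧ x.1.1 = x.2.1 then d x.1.1 else 0) else 0 := by
    split_ifs with h <;> simp [diagVec_blk, *]
  rw [e]
  grind

/-- `diagVec j k` as a linear map `K³ → K^{A ⊗ B}`. [folklore] -/
def diagVecLin (j k : Fin 3) : (Fin 3 → K) →ₗ[K] (I9' × I9' → K) where
  toFun := diagVec j k
  map_add' := diagVec_add j k
  map_smul' := diagVec_smul j k

/-- `diagVec j k` is injective: its diagonal entries are `d`. [folklore] -/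
theorem diagVec_injective (j k : Fin 3) : Function.Injective (diagVec (K := K) j k) := by
  intro d d' h
  funext i
  have := congr_fun h (blk j k i i)
  simpa using this

/-! ## Admissible subspaces -/

/-- **Admissible `(110)`-subspaces of `⟨3,3,3⟩`**: the intrinsic consequences of "torus graded,
Borel fixed, contains the nine slices, dimension `≤ 16`" used by the classification — `E`
contains the root-coordinate and block-diagonal components of its elements and the nine identity
matrices, is stable under `ad X_{pq}` in the blocks and under the block shifts (`p < q`), and
`dim E ≤ 16`. [cite: ConnerHarperLandsberg2023, §2.5 and §6] -/
structure IsAdmissible (E : Submodule K (I9' × I9' → K)) : Prop where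
  /-- root-coordinate components of elements lie in `E` -/
  unit_mem : ∀ j k i i', i ≠ i' → ∀ x ∈ E, (Pi.single (blk j k i i') (x (blk j k i i')) : _ → K) ∈ E
  /-- block-diagonal components of elements lie in `E` -/
  diag_mem : ∀ j k, ∀ x ∈ E, diagProj j k x ∈ E
  /-- the identity matrix of every block (a slice of `⟨3,3,3⟩`) lies in `E` -/
  id_mem : ∀ j k, diagVec j k (fun _ => (1 : K)) ∈ E
  /-- stability under `ad X_{pq}`, `p < q` -/
  adU_mem : ∀ p q, p < q → ∀ x ∈ E, adU p q x ∈ E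
  /-- stability under the block-row shifts -/
  shiftV_mem : ∀ p q, p < q → ∀ x ∈ E, shiftV p q x ∈ E
  /-- stability under the block-column shifts -/
  shiftW_mem : ∀ p q, p < q → ∀ x ∈ E, shiftW p q x ∈ E
  /-- `dim E ≤ 16` -/
  finrank_le : Module.finrank K E ≤ 16

/-- The diagonal part of `E` in block `(j,k)`, as a subspace of `K³` (contains the constants).
[cite: ConnerHarperLandsberg2023, §6] -/
def diagSub (E : Submodule K (I9' × I9' → K)) (j k : Fin 3) : Submodule K (Fin 3 → K) :=
  E.comap (diagVecLin j k)

/-- Membership in `diagSub`. [folklore] -/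
theorem mem_diagSub {E : Submodule K (I9' × I9' → K)} {j k : Fin 3} {d : Fin 3 → K} :
    d ∈ diagSub E j k ↔ diagVec j k d ∈ E := Iff.rfl

open Classical in
/-- The root positions `(i, i')`, `i ≠ i'`, of block `(j,k)` whose unit vector lies in `E`.
[cite: ConnerHarperLandsberg2023, §6] -/
def rootSet (E : Submodule K (I9' × I9' → K)) (j k : Fin 3) : Finset (Fin 3 × Fin 3) :=
  Finset.univ.filter fun ii' => ii'.1 ≠ ii'.2 ∧ unitVec (K := K) j k ii'.1 ii'.2 ∈ E

/-- Membership in `rootSet`. [folklore] -/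
theorem mem_rootSet {E : Submodule K (I9' × I9' → K)} {j k i i' : Fin 3} :
    (i, i') ∈ rootSet E j k ↔ i ≠ i' ∧ unitVec (K := K) j k i i' ∈ E := by
  classical
  simp [rootSet]

section Consequences

variable {E : Submodule K (I9' × I9' → K)} (hE : IsAdmissible E)
include hE

/-- A non-zero root coordinate of an element of `E` marks an active root. [folklore] -/
theorem IsAdmissible.mem_rootSet_of_apply_ne_zero {x : I9' × I9' → K} (hx : x ∈ E)
    {j k i i' : Fin 3} (hii' : i ≠ i') (h : x (blk j k i i') ≠ 0) : (i, i') ∈ rootSet E j k := by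
  refine mem_rootSet.2 ⟨hii', ?_⟩
  have h1 := hE.unit_mem j k i i' hii' x hx
  have : unitVec (K := K) j k i i' = (x (blk j k i i'))⁻¹ • Pi.single (blk j k i i') (x (blk j k i i')) := by
    rw [unitVec, ← Pi.single_smul', smul_eq_mul, inv_mul_cancel₀ h]
  rw [this]
  exact Submodule.smul_mem _ _ h1

/-- The constants lie in every diagonal part. [folklore] -/
theorem IsAdmissible.one_mem_diagSub (j k : Fin 3) : (fun _ => (1 : K)) ∈ diagSub E j k :=
  hE.id_mem j k

/-- **A missing positive root forces an equality of diagonal entries**: if `X_{pq} ∉ E` (`p < q`)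
then every diagonal `d` of block `(j,k)` in `E` has `d_p = d_q` (since
`ad X_{pq} (diag d) = (d_q - d_p) X_{pq}`). [cite: ConnerHarperLandsberg2023, §2.5] -/
theorem IsAdmissible.apply_eq_of_not_mem_rootSet {p q : Fin 3} (hpq : p < q) {j k : Fin 3}
    (hR : (p, q) ∉ rootSet E j k) {d : Fin 3 → K} (hd : d ∈ diagSub E j k) : d p = d q := by
  by_contra hne
  apply hR
  refine mem_rootSet.2 ⟨hpq.ne, ?_⟩
  have h1 := hE.adU_mem p q hpq _ (mem_diagSub.1 hd)
  rw [adU_diagVec] at h1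
  have hc : d q - d p ≠ 0 := sub_ne_zero.2 (Ne.symm hne)
  have : unitVec (K := K) j k p q = (d q - d p)⁻¹ • ((d q - d p) • unitVec (K := K) j k p q) := by
    rw [smul_smul, inv_mul_cancel₀ hc, one_smul]
  rw [this]
  exact Submodule.smul_mem _ _ h1

/-- **A negative root forces its coroot**: if `X_{qp} ∈ E` (`p < q`) then the diagonal
`e_p - e_q` of block `(j,k)` lies in `E` (it is `ad X_{pq} X_{qp}`). [cite: ConnerHarperLandsberg2023, §2.5] -/
theorem IsAdmissible.coroot_mem {p q : Fin 3} (hpq : p < q) {j k : Fin 3}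
    (hR : (q, p) ∈ rootSet E j k) :
    (Pi.single p (1 : K) - Pi.single q 1 : Fin 3 → K) ∈ diagSub E j k := by
  have h1 := hE.adU_mem p q hpq _ (mem_rootSet.1 hR).2
  rw [adU_unitVec, if_pos rfl, if_pos rfl] at h1
  rw [mem_diagSub]
  convert h1 using 1
  funext c
  rw [← blk_eta c, diagVec_blk]
  simp only [Pi.sub_apply, Pi.single_apply, blk_inj]
  grind

/-- **Upper-set closure, first rule**: `X_{i i'} ∈ E`, `i = q`, `i' ≠ p` (`p < q`) give
`X_{p i'} ∈ E`. [cite: ConnerHarperLandsberg2023, §2.5] -/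
theorem IsAdmissible.mem_rootSet_left {p q : Fin 3} (hpq : p < q) {j k i' : Fin 3}
    (hR : (q, i') ∈ rootSet E j k) (hi'p : i' ≠ p) : (p, i') ∈ rootSet E j k := by
  have h1 := hE.adU_mem p q hpq _ (mem_rootSet.1 hR).2
  rw [adU_unitVec, if_pos rfl, if_neg hi'p, sub_zero] at h1
  exact mem_rootSet.2 ⟨Ne.symm hi'p, h1⟩

/-- **Upper-set closure, second rule**: `X_{i i'} ∈ E`, `i' = p`, `i ≠ q` (`p < q`) give
`X_{i q} ∈ E`. [cite: ConnerHarperLandsberg2023, §2.5] -/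
theorem IsAdmissible.mem_rootSet_right {p q : Fin 3} (hpq : p < q) {j k i : Fin 3}
    (hR : (i, p) ∈ rootSet E j k) (hiq : i ≠ q) : (i, q) ∈ rootSet E j k := by
  have h1 := hE.adU_mem p q hpq _ (mem_rootSet.1 hR).2
  rw [adU_unitVec, if_neg (Ne.symm hiq), if_pos rfl, zero_sub] at h1
  exact mem_rootSet.2 ⟨hiq, by simpa [unitVec] using Submodule.neg_mem _ h1⟩

/-- **Block rows decrease**: `rootSet (q,k) ⊆ rootSet (p,k)` for `p < q`.
[cite: ConnerHarperLandsberg2023, §2.5] -/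
theorem IsAdmissible.rootSet_mono_row {p q : Fin 3} (hpq : p < q) (k : Fin 3) :
    rootSet E q k ⊆ rootSet E p k := by
  intro ii' h
  obtain ⟨i, i'⟩ := ii'
  obtain ⟨hne, hmem⟩ := mem_rootSet.1 h
  have h1 := hE.shiftV_mem p q hpq _ hmem
  rw [unitVec, shiftV_single, if_pos rfl] at h1
  exact mem_rootSet.2 ⟨hne, h1⟩

/-- **Block columns decrease**: `rootSet (j,q) ⊆ rootSet (j,p)` for `p < q`.
[cite: ConnerHarperLandsberg2023, §2.5] -/
theorem IsAdmissible.rootSet_mono_col {p q : Fin 3} (hpq : p < q) (j : Fin 3) :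
    rootSet E j q ⊆ rootSet E j p := by
  intro ii' h
  obtain ⟨i, i'⟩ := ii'
  obtain ⟨hne, hmem⟩ := mem_rootSet.1 h
  have h1 := hE.shiftW_mem p q hpq _ hmem
  rw [unitVec, shiftW_single, if_pos rfl] at h1
  exact mem_rootSet.2 ⟨hne, h1⟩

/-- **Diagonal parts decrease along block rows.** [cite: ConnerHarperLandsberg2023, §2.5] -/
theorem IsAdmissible.diagSub_mono_row {p q : Fin 3} (hpq : p < q) (k : Fin 3) :
    diagSub E q k ≤ diagSub E p k := by
  intro d hd
  have h1 := hE.shiftV_mem p q hpq _ (mem_diagSub.1 hd)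
  rw [shiftV_diagVec, if_pos rfl] at h1
  exact h1

/-- **Diagonal parts decrease along block columns.** [cite: ConnerHarperLandsberg2023, §2.5] -/
theorem IsAdmissible.diagSub_mono_col {p q : Fin 3} (hpq : p < q) (j : Fin 3) :
    diagSub E j q ≤ diagSub E j p := by
  intro d hd
  have h1 := hE.shiftW_mem p q hpq _ (mem_diagSub.1 hd)
  rw [shiftW_diagVec, if_pos rfl] at h1
  exact h1

end Consequences

end MatMul3

end BorderApolarity

end Literature.Computability.AlgebraicComplexity

end
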